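import Literature.NumberTheory.Automorphic.HyperspecialUnitarySatakeTransform
import Literature.NumberTheory.Automorphic.HyperspecialUnitaryIwasawaCartan
import HarnessLib

/-!
# The Satake transform of `ℋ(U(σ, J₀), K₀)` is injective (Cartier 1979, Thm. 4.1, injectivity half; via
# Bruhat–Tits (4.4.4) (i))

Topic `NumberTheory/Automorphic`; namespace `Literature.NumberTheory.Automorphic.HermitianLattice` and
`…HermitianLattice.UnramifiedLocalConjDatum` (lane `lit-hodgefound`, Track 2 foundations; seat `lit-hodgefound-p11`,
generation 36, row g36-#8).  THEOREMS ONLY: no definition, no named fact, no instance, no notation.  Sequel of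
`HyperspecialUnitarySatakeTransform` (the algebra homomorphism `𝒮 = UnramifiedLocalConjDatum.satakeTransform :
ℋ(U(σ, J₀), K₀) →ₐ[ℂ] ℂ[ℤ^N]`) and `HyperspecialUnitaryIwasawaCartan` (Bruhat–Tits (4.4.4) (i): the Iwasawa exponents
of the cosets in `K₀ diag(ϖ^a) K₀` are dominated by `a`).

Setting: `K` a field with `Valued K ℤᵐ⁰` and finite residue field, `UnramifiedLocalConjDatum σ ϖ`,
`G = U(σ, J₀) = unitaryGroupOfForm σ (J₀.over K)`, `K₀ = unitaryInt σ (J₀.over K)`, `a(γ) = iwasawaExp` the Iwasawa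
exponents of a coset `γ ∈ G / K₀`.

## The print

[CartierCorvallis1979] §IV Thm. 4.1: «The Satake transform is an algebra isomorphism of `ℋ(G, K)` onto `ℂ[Λ]^W`»;
proof, steps (b)–(c): the images `Sc_λ` of the basis `c_λ = 𝟙_{K ϖ^λ K}` are triangular with respect to the
dominance order with non-zero leading coefficient, hence linearly independent.  The triangularity is
[BruhatTits1972] Prop. (4.4.4) (i) («Si `K.t.K ∩ B̂⁰.t'.K ≠ ∅`, on a `t' ≤ t`», formalised in
`HyperspecialUnitaryIwasawaCartan`) and the leading term is (ii) («`K.t.K ∩ B̂⁰.t.K = t.K`»; here only `⊇`, which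
suffices).  Here the linear-independence argument is run on an arbitrary `K₀`-invariant vector `v ∈ ℂ[G / K₀]`
instead of a basis expansion: choose `γ₀ ∈ supp v` maximising the head-sum vector of `a(γ)` in the lexicographic
order (a linear refinement of dominance, §1); then every `γ ∈ supp v` with `a(γ) = a(γ₀)` lies in the double coset
`K₀ diag(ϖ^{a(γ₀)}) K₀` (§2, by Cartan + (4.4.4) (i)), on which `v` is constant, so the coefficient of `x^{a(γ₀)}` in
`𝒮v` is a positive multiple of `v(γ₀) ≠ 0`.  The SURJECTIVITY onto the Weyl invariants (the other half of Thm. 4.1) is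
NOT claimed.

## What is formalised

* §1 `toLex_headSum_le_of_forall_le`, `eq_of_forall_le_of_toLex_le` (head sums in `Lex (Fin N → ℤ)` refine dominance).
* §2 `UnramifiedLocalConjDatum.coeff_satakeVec` (coefficient formula), **`mem_orbit_of_isMax_headSum`** (the cosets with
  the maximal exponent lie in ONE double coset, and that exponent is antitone), **`eq_zero_of_satakeVec_eq_zero`** (a
  non-zero `K₀`-invariant vector has non-zero transform), **`satakeTransform_injective`** — `𝒮` IS INJECTIVE.
* §3 `sum_le_of_coeff_satakeTransform_doubleCosetOperator_ne_zero` (TRIANGULARITY: `x^μ` occurs in `𝒮(T_{diag(ϖ^a)})`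
  only for `μ` dominated by `a`), `coeff_self_satakeTransform_doubleCosetOperator_ne_zero` (the leading coefficient
  `#{γ : a(γ) = a} · q^{-⟨ν,a⟩/2}` is non-zero).

## References
* [CartierCorvallis1979] P. Cartier, *Representations of 𝔭-adic groups: a survey*, PSPM 33.1 (1979), §IV, Thm. 4.1 and
  its proof.
* [BruhatTits1972] F. Bruhat, J. Tits, *Groupes réductifs sur un corps local. I*, Publ. Math. IHÉS 41 (1972), (4.4.4).
* [Satake1963] I. Satake, *Theory of spherical functions on reductive algebraic groups over 𝔭-adic fields*,
  Publ. Math. IHÉS 18 (1963), §6.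
-/

noncomputable section

open scoped Valued WithZero Matrix MatrixGroups
open MonoidAlgebra Representation Finset

namespace Literature.NumberTheory.Automorphic.HermitianLattice

open Literature.NumberTheory.Automorphic.CartanUnique Literature.NumberTheory.Automorphic.SymplecticCartan

variable {N : ℕ}

/-! ## §1 A linear refinement of the dominance order: head sums in the lexicographic order -/

/-- Dominance implies the lexicographic inequality of the head-sum vectors. [cite: BruhatTits1972, (4.4.4)] -/
theorem toLex_headSum_le_of_forall_le {μ ν : Fin N → ℤ}
    (h : ∀ r : ℕ, (∑ i : Fin N, if (i : ℕ) < r then μ i else 0) ≤ ∑ i : Fin N, if (i : ℕ) < r then ν i else 0) :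
    toLex (fun r : Fin N => ∑ i : Fin N, if (i : ℕ) < (r : ℕ) + 1 then μ i else 0) ≤
      toLex (fun r : Fin N => ∑ i : Fin N, if (i : ℕ) < (r : ℕ) + 1 then ν i else 0) :=
  Pi.toLex_monotone fun r => h ((r : ℕ) + 1)

/-- If `μ` is dominated by `ν` and the head-sum vector of `ν` is lexicographically `≤` that of `μ`, then `μ = ν`.
[cite: BruhatTits1972, (4.4.4)] -/
theorem eq_of_forall_le_of_toLex_le {μ ν : Fin N → ℤ}
    (h : ∀ r : ℕ, (∑ i : Fin N, if (i : ℕ) < r then μ i else 0) ≤ ∑ i : Fin N, if (i : ℕ) < r then ν i else 0)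
    (hle : toLex (fun r : Fin N => ∑ i : Fin N, if (i : ℕ) < (r : ℕ) + 1 then ν i else 0) ≤
      toLex (fun r : Fin N => ∑ i : Fin N, if (i : ℕ) < (r : ℕ) + 1 then μ i else 0)) : μ = ν := by
  have hpt : (fun r : Fin N => ∑ i : Fin N, if (i : ℕ) < (r : ℕ) + 1 then μ i else 0) ≤
      fun r : Fin N => ∑ i : Fin N, if (i : ℕ) < (r : ℕ) + 1 then ν i else 0 := fun r => h ((r : ℕ) + 1)
  have heq : (fun r : Fin N => ∑ i : Fin N, if (i : ℕ) < (r : ℕ) + 1 then μ i else 0) =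
      fun r : Fin N => ∑ i : Fin N, if (i : ℕ) < (r : ℕ) + 1 then ν i else 0 := by
    by_contra hne
    exact absurd hle (not_le.2 (Pi.toLex_strictMono (lt_of_le_of_ne hpt hne)))
  refine eq_of_forall_sum_ite_lt_eq fun r => ?_
  rcases Nat.eq_zero_or_pos r with rfl | hr
  · simp
  · by_cases hrN : r ≤ N
    · have := congr_fun heq ⟨r - 1, by omega⟩
      have hr1 : r - 1 + 1 = r := by omega
      simpa [hr1] using this
    · rcases Nat.eq_zero_or_pos N with hN | hN
      · subst hN
        simp
      · have := congr_fun heq ⟨N - 1, by omega⟩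
        have h1 : ∀ φ : Fin N → ℤ, (∑ i : Fin N, if (i : ℕ) < r then φ i else 0) =
            ∑ i : Fin N, if (i : ℕ) < (N - 1 : ℕ) + 1 then φ i else 0 := fun φ =>
          Finset.sum_congr rfl fun i _ => by rw [if_pos (by omega), if_pos (by have := i.isLt; omega)]
        rw [h1, h1]
        exact this

variable {K : Type*} [Field K] [Valued K ℤᵐ⁰] {σ : K →+* K} {ϖ : K}

namespace UnramifiedLocalConjDatum

/-! ## §2 The leading exponent of a `K₀`-invariant vector and the injectivity of the Satake transform -/

/-- **Coefficient formula**: the coefficient of `x^μ` in `satakeVec v` is `q^{-⟨ν, μ⟩/2} · ∑_{γ : a(γ) = μ} v(γ)`.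
[cite: CartierCorvallis1979, §IV (4.2)] -/
theorem coeff_satakeVec (hd : UnramifiedLocalConjDatum σ ϖ)
    (v : MonoidAlgebra ℂ (unitaryGroupOfForm σ ((StdForm.antidiagonal N).over K) ⧸ unitaryInt σ ((StdForm.antidiagonal N).over K)))
    (μ : Fin N → ℤ) :
    (hd.satakeVec v).coeff μ =
      ∑ γ ∈ v.coeff.support, if hd.iwasawaExp γ.out = μ then v.coeff γ * satakeWeight (residueCardSqrt K) μ else 0 := by
  classical
  rw [satakeVec_apply, AddMonoidAlgebra.coeff_sum, Finsupp.finsetSum_apply]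
  refine Finset.sum_congr rfl fun γ _ => ?_
  rw [AddMonoidAlgebra.coeff_smul, Finsupp.smul_apply, AddMonoidAlgebra.coeff_single, Finsupp.single_apply, smul_eq_mul]
  split_ifs with h
  · rw [h]
  · rw [mul_zero]

/-- **The cosets with a given DOMINANT-MAXIMAL exponent lie in one double coset.**  Let `v ∈ ℂ[U(σ, J₀) / K₀]` and let
`γ₀ ∈ supp v` maximise the head-sum vector of `a(γ)` lexicographically over `supp v`, `v` being `K₀`-invariant.  Then
`a(γ₀)` is antitone, and every `γ ∈ supp v` with `a(γ) = a(γ₀)` lies in the `K₀`-orbit of `diag(ϖ^{a(γ₀)}) K₀` — by the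
Cartan decomposition of `γ` and Bruhat–Tits (4.4.4) (i). [cite: BruhatTits1972, (4.4.4) (i)]
[cite: CartierCorvallis1979, §IV, proof of Thm. 4.1] -/
theorem mem_orbit_of_isMax_headSum (hd : UnramifiedLocalConjDatum σ ϖ)
    {v : MonoidAlgebra ℂ (unitaryGroupOfForm σ ((StdForm.antidiagonal N).over K) ⧸ unitaryInt σ ((StdForm.antidiagonal N).over K))}
    (hv : ∀ k ∈ unitaryInt σ ((StdForm.antidiagonal N).over K),
      ofMulAction ℂ (unitaryGroupOfForm σ ((StdForm.antidiagonal N).over K))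
        (unitaryGroupOfForm σ ((StdForm.antidiagonal N).over K) ⧸ unitaryInt σ ((StdForm.antidiagonal N).over K)) k v = v)
    {γ₀ : unitaryGroupOfForm σ ((StdForm.antidiagonal N).over K) ⧸ unitaryInt σ ((StdForm.antidiagonal N).over K)}
    (hmax : ∀ γ ∈ v.coeff.support,
      toLex (fun r : Fin N => ∑ i : Fin N, if (i : ℕ) < (r : ℕ) + 1 then hd.iwasawaExp γ.out i else 0) ≤
        toLex (fun r : Fin N => ∑ i : Fin N, if (i : ℕ) < (r : ℕ) + 1 then hd.iwasawaExp γ₀.out i else 0))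
    {γ : unitaryGroupOfForm σ ((StdForm.antidiagonal N).over K) ⧸ unitaryInt σ ((StdForm.antidiagonal N).over K)}
    (hγ : γ ∈ v.coeff.support) (hγe : hd.iwasawaExp γ.out = hd.iwasawaExp γ₀.out) :
    ∃ ha : Antitone (hd.iwasawaExp γ₀.out) ∧ ∀ i, hd.iwasawaExp γ₀.out (Fin.rev i) = -hd.iwasawaExp γ₀.out i,
      γ ∈ MulAction.orbit (unitaryInt σ ((StdForm.antidiagonal N).over K))
        (((⟨zpowDiagGL (uniformizer_ne_zero hd.vϖ) (hd.iwasawaExp γ₀.out), zpowDiagGL_mem_unitaryGroupOfForm hd.σϖ _ ha.2⟩ :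
          unitaryGroupOfForm σ ((StdForm.antidiagonal N).over K)) :
          unitaryGroupOfForm σ ((StdForm.antidiagonal N).over K) ⧸ unitaryInt σ ((StdForm.antidiagonal N).over K))) := by
  -- Cartan decomposition of `γ`: `γ ∈ K₀ diag(ϖ^b) K₀` with `b` antitone
  obtain ⟨b, hb, hmk⟩ := heckeCosetMk_zpowDiagGL_eq_of_unitary hd γ.out
  obtain ⟨A, hA, B, hB, hAB⟩ := (heckeAlgebra.heckeCosetMk_eq_iff (unitaryInt σ ((StdForm.antidiagonal N).over K))
    (Submonoid.mem_top _) (Submonoid.mem_top _)).1 hmk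
  set tb : unitaryGroupOfForm σ ((StdForm.antidiagonal N).over K) :=
    ⟨zpowDiagGL (uniformizer_ne_zero hd.vϖ) b, zpowDiagGL_mem_unitaryGroupOfForm hd.σϖ _ hb.2⟩ with htb
  have hγorb : (γ.out : unitaryGroupOfForm σ ((StdForm.antidiagonal N).over K) ⧸ unitaryInt σ ((StdForm.antidiagonal N).over K)) ∈
      MulAction.orbit (unitaryInt σ ((StdForm.antidiagonal N).over K))
        ((tb : unitaryGroupOfForm σ ((StdForm.antidiagonal N).over K)) :
          unitaryGroupOfForm σ ((StdForm.antidiagonal N).over K) ⧸ unitaryInt σ ((StdForm.antidiagonal N).over K)) :=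
    (heckeAlgebra.coe_mem_orbit_coe_iff (unitaryInt σ ((StdForm.antidiagonal N).over K)) _ _).2 ⟨A, hA, B, hB, hAB⟩
  have hγorb' : γ ∈ MulAction.orbit (unitaryInt σ ((StdForm.antidiagonal N).over K))
        ((tb : unitaryGroupOfForm σ ((StdForm.antidiagonal N).over K)) :
          unitaryGroupOfForm σ ((StdForm.antidiagonal N).over K) ⧸ unitaryInt σ ((StdForm.antidiagonal N).over K)) := by
    have h := hγorb
    rwa [QuotientGroup.out_eq'] at h
  -- the coset of `diag(ϖ^b)` is in the support, with exponent `b`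
  have htborb : ((tb : unitaryGroupOfForm σ ((StdForm.antidiagonal N).over K)) :
        unitaryGroupOfForm σ ((StdForm.antidiagonal N).over K) ⧸ unitaryInt σ ((StdForm.antidiagonal N).over K)) ∈
      MulAction.orbit (unitaryInt σ ((StdForm.antidiagonal N).over K)) γ := by
    rw [MulAction.orbit_eq_iff.2 hγorb']
    exact MulAction.mem_orbit_self _
  have hcoeff : v.coeff ((tb : unitaryGroupOfForm σ ((StdForm.antidiagonal N).over K)) :
      unitaryGroupOfForm σ ((StdForm.antidiagonal N).over K) ⧸ unitaryInt σ ((StdForm.antidiagonal N).over K)) = v.coeff γ :=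
    heckeAlgebra.coeff_eq_of_mem_orbit (unitaryInt σ ((StdForm.antidiagonal N).over K)) hv htborb
  have htbS : ((tb : unitaryGroupOfForm σ ((StdForm.antidiagonal N).over K)) :
      unitaryGroupOfForm σ ((StdForm.antidiagonal N).over K) ⧸ unitaryInt σ ((StdForm.antidiagonal N).over K)) ∈ v.coeff.support := by
    rw [Finsupp.mem_support_iff, hcoeff]
    exact Finsupp.mem_support_iff.1 hγ
  have hetb : hd.iwasawaExp (((tb : unitaryGroupOfForm σ ((StdForm.antidiagonal N).over K)) :
      unitaryGroupOfForm σ ((StdForm.antidiagonal N).over K) ⧸ unitaryInt σ ((StdForm.antidiagonal N).over K))).out = b :=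
    hd.iwasawaExp_out_zpowDiagGL hb.2
  -- maximality and dominance squeeze: `a(γ) = a(γ₀) ≤ b` (head sums) and `hs(b) ≤ hs(a(γ₀))` lexicographically
  have h1 := hmax _ htbS
  rw [hetb] at h1
  have h2 : ∀ r : ℕ, (∑ i : Fin N, if (i : ℕ) < r then hd.iwasawaExp γ₀.out i else 0) ≤
      ∑ i : Fin N, if (i : ℕ) < r then b i else 0 := fun r => by
    rw [← hγe]
    exact hd.sum_iwasawaExp_head_le hb hγorb r
  have hab : hd.iwasawaExp γ₀.out = b := eq_of_forall_le_of_toLex_le h2 h1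
  subst hab
  exact ⟨hb, hγorb'⟩

variable [Finite 𝓀[K]]

/-- **A non-zero `K₀`-invariant vector has a non-zero Satake transform**: with `γ₀` as above (`a = a(γ₀)` the
lexicographically maximal head-sum exponent on `supp v`), the coefficient of `x^a` in `satakeVec v` is
`#{γ ∈ K₀ diag(ϖ^a) K₀ / K₀ : a(γ) = a} · v(γ₀) · q^{-⟨ν,a⟩/2} ≠ 0`, since all `γ` with `a(γ) = a` lie in the double coset of
`diag(ϖ^a)` (`mem_orbit_of_isMax_headSum`) on which `v` is constant. [cite: CartierCorvallis1979, §IV, proof of Thm. 4.1]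
[cite: BruhatTits1972, (4.4.4) (i)] -/
theorem eq_zero_of_satakeVec_eq_zero (hd : UnramifiedLocalConjDatum σ ϖ)
    {v : MonoidAlgebra ℂ (unitaryGroupOfForm σ ((StdForm.antidiagonal N).over K) ⧸ unitaryInt σ ((StdForm.antidiagonal N).over K))}
    (hv : ∀ k ∈ unitaryInt σ ((StdForm.antidiagonal N).over K),
      ofMulAction ℂ (unitaryGroupOfForm σ ((StdForm.antidiagonal N).over K))
        (unitaryGroupOfForm σ ((StdForm.antidiagonal N).over K) ⧸ unitaryInt σ ((StdForm.antidiagonal N).over K)) k v = v)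
    (h0 : hd.satakeVec v = 0) : v = 0 := by
  classical
  by_contra hne
  have hSne : v.coeff.support.Nonempty := by
    rw [Finsupp.support_nonempty_iff, Ne, MonoidAlgebra.coeff_eq_zero]
    exact hne
  obtain ⟨γ₀, hγ₀S, hmax⟩ := v.coeff.support.exists_max_image
    (fun γ => toLex (fun r : Fin N => ∑ i : Fin N, if (i : ℕ) < (r : ℕ) + 1 then hd.iwasawaExp γ.out i else 0)) hSne
  set a := hd.iwasawaExp γ₀.out with ha_def
  obtain ⟨ha, -⟩ := hd.mem_orbit_of_isMax_headSum hv hmax hγ₀S rfl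
  -- the coefficient of `x^a`
  have hcoef := hd.coeff_satakeVec v a
  rw [h0, AddMonoidAlgebra.coeff_zero, Finsupp.zero_apply] at hcoef
  -- every `γ ∈ supp v` with `a(γ) = a` has `v(γ) = v(γ₀)`
  have hconst : ∀ γ ∈ v.coeff.support, hd.iwasawaExp γ.out = a → v.coeff γ = v.coeff γ₀ := by
    intro γ hγ hγe
    obtain ⟨_, hγorb⟩ := hd.mem_orbit_of_isMax_headSum hv hmax hγ hγe
    obtain ⟨_, hγ₀orb⟩ := hd.mem_orbit_of_isMax_headSum hv hmax hγ₀S rfl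
    exact (heckeAlgebra.coeff_eq_of_mem_orbit (unitaryInt σ ((StdForm.antidiagonal N).over K)) hv hγorb).trans
      (heckeAlgebra.coeff_eq_of_mem_orbit (unitaryInt σ ((StdForm.antidiagonal N).over K)) hv hγ₀orb).symm
  have hsum : (∑ γ ∈ v.coeff.support, if hd.iwasawaExp γ.out = a then v.coeff γ * satakeWeight (residueCardSqrt K) a else 0) =
      ((v.coeff.support.filter fun γ => hd.iwasawaExp γ.out = a).card : ℂ) * (v.coeff γ₀ * satakeWeight (residueCardSqrt K) a) := by
    rw [← Finset.sum_filter]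
    rw [Finset.sum_congr rfl fun γ hγ => by
      rw [hconst γ (Finset.mem_filter.1 hγ).1 (Finset.mem_filter.1 hγ).2]]
    rw [Finset.sum_const, nsmul_eq_mul]
  rw [hsum] at hcoef
  have hγ₀f : γ₀ ∈ v.coeff.support.filter fun γ => hd.iwasawaExp γ.out = a := Finset.mem_filter.2 ⟨hγ₀S, rfl⟩
  refine absurd hcoef.symm (mul_ne_zero ?_ (mul_ne_zero (Finsupp.mem_support_iff.1 hγ₀S)
    (satakeWeight_ne_zero residueCardSqrt_ne_zero a)))
  exact Nat.cast_ne_zero.2 (Finset.card_ne_zero.2 ⟨γ₀, hγ₀f⟩)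

/-- **THE SATAKE TRANSFORM OF `ℋ(U(σ, J₀), K₀)` IS INJECTIVE** (the injectivity half of the Satake isomorphism,
[CartierCorvallis1979] Thm. 4.1, for the quasi-split unitary group at an unramified place): `𝒮(T) = satakeVec (T[K₀])` with
`T[K₀]` a `K₀`-invariant vector determining `T` (`heckeAlgebra.toVector_injective`), and `eq_zero_of_satakeVec_eq_zero`.
[cite: CartierCorvallis1979, §IV Thm. 4.1] [cite: BruhatTits1972, (4.4.4) (i)] -/
theorem satakeTransform_injective (hd : UnramifiedLocalConjDatum σ ϖ) :
    Function.Injective (hd.satakeTransform (N := N)) := by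
  refine (injective_iff_map_eq_zero _).2 fun T hT => ?_
  rw [satakeTransform_apply] at hT
  have hv := hd.eq_zero_of_satakeVec_eq_zero
    (fun a ha => heckeAlgebra.ofMulAction_toVector (unitaryInt σ ((StdForm.antidiagonal N).over K)) T ha) hT
  exact heckeAlgebra.toVector_injective (unitaryInt σ ((StdForm.antidiagonal N).over K)) (by rw [hv, map_zero])

/-! ## §3 Triangularity of `𝒮(T_a)` -/

/-- **Triangularity of the Satake transform of a double-coset operator**: if `x^μ` occurs in `𝒮(T_{diag(ϖ^a)})` (`a`
antitone, `a ∘ rev = -a`), then `μ` is dominated by `a` — Cartier's «`Sc_λ = … + lower terms`», here from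
Bruhat–Tits (4.4.4) (i). [cite: CartierCorvallis1979, §IV, proof of Thm. 4.1] [cite: BruhatTits1972, (4.4.4) (i)] -/
theorem sum_le_of_coeff_satakeTransform_doubleCosetOperator_ne_zero (hd : UnramifiedLocalConjDatum σ ϖ)
    [IsHeckeTriple (⊤ : Submonoid (unitaryGroupOfForm σ ((StdForm.antidiagonal N).over K)))
      (unitaryInt σ ((StdForm.antidiagonal N).over K)) (unitaryInt σ ((StdForm.antidiagonal N).over K))]
    {a : Fin N → ℤ} (ha : Antitone a ∧ ∀ i, a (Fin.rev i) = -a i) {μ : Fin N → ℤ}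
    (hμ : (hd.satakeTransform (heckeAlgebra.doubleCosetOperator (unitaryInt σ ((StdForm.antidiagonal N).over K))
      (⟨zpowDiagGL (uniformizer_ne_zero hd.vϖ) a, zpowDiagGL_mem_unitaryGroupOfForm hd.σϖ _ ha.2⟩ :
        unitaryGroupOfForm σ ((StdForm.antidiagonal N).over K)))).coeff μ ≠ 0) (r : ℕ) :
    (∑ i : Fin N, if (i : ℕ) < r then μ i else 0) ≤ ∑ i : Fin N, if (i : ℕ) < r then a i else 0 := by
  classical
  rw [satakeTransform_doubleCosetOperator, AddMonoidAlgebra.coeff_sum, Finsupp.finsetSum_apply] at hμ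
  obtain ⟨α, hα, hne⟩ := Finset.exists_ne_zero_of_sum_ne_zero hμ
  rw [AddMonoidAlgebra.coeff_single, Finsupp.single_apply] at hne
  have hαμ : hd.iwasawaExp α.out = μ := by
    by_contra h
    exact hne (if_neg h)
  rw [← hαμ]
  have hαorb : (α.out : unitaryGroupOfForm σ ((StdForm.antidiagonal N).over K) ⧸ unitaryInt σ ((StdForm.antidiagonal N).over K)) ∈
      MulAction.orbit (unitaryInt σ ((StdForm.antidiagonal N).over K))
        (((⟨zpowDiagGL (uniformizer_ne_zero hd.vϖ) a, zpowDiagGL_mem_unitaryGroupOfForm hd.σϖ _ ha.2⟩ :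
          unitaryGroupOfForm σ ((StdForm.antidiagonal N).over K)) :
          unitaryGroupOfForm σ ((StdForm.antidiagonal N).over K) ⧸ unitaryInt σ ((StdForm.antidiagonal N).over K))) := by
    rw [QuotientGroup.out_eq']
    exact (Set.Finite.mem_toFinset _).1 hα
  exact hd.sum_iwasawaExp_head_le ha hαorb r

/-- **The leading term of `𝒮(T_a)`**: the coefficient of `x^a` in `𝒮(T_{diag(ϖ^a)})` is
`#{γ ⊆ K₀ diag(ϖ^a) K₀ : a(γ) = a} · q^{-⟨ν,a⟩/2} ≠ 0` (the coset `diag(ϖ^a) K₀` contributes).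
[cite: CartierCorvallis1979, §IV, proof of Thm. 4.1] [cite: BruhatTits1972, (4.4.4) (ii)] -/
theorem coeff_self_satakeTransform_doubleCosetOperator_ne_zero (hd : UnramifiedLocalConjDatum σ ϖ)
    [IsHeckeTriple (⊤ : Submonoid (unitaryGroupOfForm σ ((StdForm.antidiagonal N).over K)))
      (unitaryInt σ ((StdForm.antidiagonal N).over K)) (unitaryInt σ ((StdForm.antidiagonal N).over K))]
    {a : Fin N → ℤ} (ha : Antitone a ∧ ∀ i, a (Fin.rev i) = -a i) :
    (hd.satakeTransform (heckeAlgebra.doubleCosetOperator (unitaryInt σ ((StdForm.antidiagonal N).over K))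
      (⟨zpowDiagGL (uniformizer_ne_zero hd.vϖ) a, zpowDiagGL_mem_unitaryGroupOfForm hd.σϖ _ ha.2⟩ :
        unitaryGroupOfForm σ ((StdForm.antidiagonal N).over K)))).coeff a ≠ 0 := by
  classical
  rw [satakeTransform_doubleCosetOperator, AddMonoidAlgebra.coeff_sum, Finsupp.finsetSum_apply]
  rw [Finset.sum_congr rfl fun α _ => by rw [AddMonoidAlgebra.coeff_single, Finsupp.single_apply]]
  have h1 : ∀ α : unitaryGroupOfForm σ ((StdForm.antidiagonal N).over K) ⧸ unitaryInt σ ((StdForm.antidiagonal N).over K),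
      (if hd.iwasawaExp α.out = a then satakeWeight (residueCardSqrt K) (hd.iwasawaExp α.out) else 0) =
        if hd.iwasawaExp α.out = a then satakeWeight (residueCardSqrt K) a else 0 := fun α => by
    split_ifs with h
    · rw [h]
    · rfl
  simp_rw [h1]
  rw [← Finset.sum_filter, Finset.sum_const, nsmul_eq_mul]
  refine mul_ne_zero (Nat.cast_ne_zero.2 (Finset.card_ne_zero.2 ⟨_, Finset.mem_filter.2
    ⟨(Set.Finite.mem_toFinset _).2 (MulAction.mem_orbit_self _), hd.iwasawaExp_out_zpowDiagGL ha.2⟩⟩))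
    (satakeWeight_ne_zero residueCardSqrt_ne_zero a)

end UnramifiedLocalConjDatum

end Literature.NumberTheory.Automorphic.HermitianLattice

end
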